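import Summits.BirchSwinnertonDyer.BirchSwinnertonDyer.Theorems.GenusKolyvaginAtTwoMinimalTwinBSDTwoIdentityDoorSupplyAllImages
import Summits.BirchSwinnertonDyer.BirchSwinnertonDyer.Theorems.GenusKolyvaginAtTwoMinimalTwinBSDTwoIdentityDoor
import HarnessLib

/-!
# Route `GenusKolyvaginAtTwo`, crux U₂ `MinimalTwinBSDTwo` (stmt-BirchSwinnertonDyer-22985), LINE 23 «twin_swap»: THE IDENTITY-PRIME DOOR, part 6 —
# UNCONDITIONAL EXISTENCE of a `2`-SELMER-TRIVIAL prime-Heegner twin on the `Δ > 0` off-egg rank-one locus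

Seat `bsd-line-gk2-p2` g26 (PROVER seat 2/3, cell `bsd-f1-sign2`, LINE 23 holder), `--supports stmt-BirchSwinnertonDyer-22985` (helper; closes nothing).
ONE THEOREM; standard axioms; **UNCONDITIONAL** (no GZK, no print fact: Čebotarev, Poitou–Tate, Tate's local Euler characteristic, Kramer's congruence and
Silverman VIII.8 are tree theorems).  **BSD is NOT proved by this file; nothing is closed.**

The identity-door chain assembled WITHOUT its only conditional input: where part 5' (`identityDoorSupplyAtTwo_allImages_of_GZK`) uses GZK to turn `r_an = 1`
into rank `1`, this file ASSUMES rank `1` (algebraic) and concludes, for every globally minimal `W/ℚ` with `rank W(ℚ) = 1`, `#Sel₂(W) = 2`, `Δ_W > 0`,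
`W(ℚ) ⊂ W⁰(ℝ)` (`¬MeetsEgg`): there are a prime `ℓ` (an IDENTITY prime: `#W(ℚ_ℓ)[2] = 4`, `Sel₂^{rel ∞}(W)` injective at `ℓ`), the field `K = ℚ(√−ℓ)`
(`d_K = −ℓ` odd `≠ −3`, Heegner for `N_W`, `2` split) and a GLOBALLY MINIMAL model `Wd` of `W^{(−ℓ)}` with **`#Sel₂(Wd) = 1`** — a Mazur–Rubin-type
«twist with trivial `2`-Selmer group» existence theorem with the Heegner side conditions built in, reusable by any line that needs a rank-`0`
`2`-Selmer-trivial twin of such a curve (twin-swap, visibility, congruence arguments).  = part 5' ∘ part 2 (`natCard_selmerGroup_twin_eq_one_of_identityDoor`).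

References: [MazurRubin2010] Thm. 1.5, Prop. 3.3, Lemma 3.5–3.6; [Kramer1981] Thm. 1; [GrossLMS1991] §1; [SilvermanAEC2009] VIII.8 Cor. 8.3, X.4.2.
-/

set_option linter.dupNamespace false -- tree convention: `Summit.BirchSwinnertonDyer.BirchSwinnertonDyer.Theorems` (summit = sub-problem)
set_option autoImplicit false

noncomputable section

open scoped Classical

namespace Summit.BirchSwinnertonDyer.BirchSwinnertonDyer.Theorems.GenusExact.TwinSwap.IdentityDoor

open Polynomial WeierstrassCurve NumberField IsDedekindDomain Field
open Literature.NumberTheory.GaloisRepresentations Literature.NumberTheory.EllipticCurves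
open Literature.NumberTheory.EllipticCurves.Rank1Residual
open Summit.BirchSwinnertonDyer.BirchSwinnertonDyer.Theorems.KolyvaginEigenTwo
open Summit.BirchSwinnertonDyer.BirchSwinnertonDyer.Theorems.GenusKolySign
open Summit.BirchSwinnertonDyer.Rank1Residual.F1Sign2 (MeetsEgg NoRationalTwoTorsion ShaTwoTrivial selmerGroupRelaxedAtInfinityAtTwo)
open Summit.BirchSwinnertonDyer.BirchSwinnertonDyer.Theorems.GenusKolyTwin (exists_heegnerField_of_prime prime_discr_facts natCard_twoTorsion_padic_eq
  isRoot_twoTorsionPolynomial_map_zmod_iff)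
open Summit.BirchSwinnertonDyer.BirchSwinnertonDyer.Theorems.GenusExact.TwinSwap.Egg (shaTwoTrivial_of_natCard_selmerGroup_eq_two)

/-! ## §6 Unconditional existence of the `2`-Selmer-trivial identity-door twin -/

/-- **`2`-SELMER-TRIVIAL PRIME-HEEGNER TWINS EXIST on the `Δ > 0` off-egg rank-one locus — UNCONDITIONAL.**  For `W/ℚ` globally minimal elliptic with
`rank W(ℚ) = 1`, `#Sel₂(W) = 2`, `Δ_W > 0` and `W(ℚ) ⊂ W⁰(ℝ)` (`¬ MeetsEgg W`): there exist a prime `ℓ`, a number field `K` with `d_K = −ℓ` (imaginary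
quadratic, `d_K` odd `≠ −3`, Heegner hypothesis for `N_W`, `2` split in `K`), such that `ℓ` is an identity prime for `W` (`#W(ℚ_ℓ)[2] = 4`) at which
`Sel₂^{rel ∞}(W)` has no non-zero class in `strictLocalKer_ℓ`, and a globally minimal `Wd ≅ W^{(d_K)}` with **`#Sel₂(Wd) = 1`**.  Proof: rank `1` and
`#Sel₂ = 2` give `E(ℚ)[2] = 0` and `Ш(W)[2] = 0`; `¬MeetsEgg` makes `Sel₂(W)` strict at `∞` and `#Sel₂^{rel ∞}(W) = 4`; the all-images Čebotarev step (part 4d)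
supplies the identity prime with `ℓ ≡ 7 (8)`, `ℓ ≡ −1 (mod p ∣ N_W)`; prime Heegner field; global minimal model; the identity-door count (part 2) gives
`#Sel₂(Wd) = 1`.  No `L`-function, no Heegner point, no GZK. [cite: MazurRubin2010, Thm. 1.5, Prop. 3.3, Lemma 3.5–3.6] [cite: Kramer1981, Thm. 1]
[cite: GrossLMS1991, §1 (p. 235)] [cite: SilvermanAEC2009, VIII.8 Cor. 8.3, X.4.2] -/
theorem exists_identityDoor_selmerTrivial_minimalTwin_of_rank_one :
    ∀ (W : WeierstrassCurve ℚ) [W.IsElliptic] [W.IsGloballyMinimal],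
      W.mordellWeilRank = 1 → Nat.card (W.selmerGroup 2) = 2 → 0 < W.Δ → ¬ MeetsEgg W →
      ∃ (K : Type) (_ : Field K) (_ : NumberField K) (ℓ : ℕ) (_ : Fact ℓ.Prime),
        IsImaginaryQuadratic K ∧ NumberField.discr K = -(ℓ : ℤ) ∧
        Nat.card {Q : (W.baseChange ℚ_[ℓ]).toAffine.Point // 2 • Q = 0} = 4 ∧
        (∀ c ∈ selmerGroupRelaxedAtInfinityAtTwo W, c ∈ MazurRubin2010.strictLocalKer W ℚ_[ℓ] 2 → c = 0) ∧
        Odd (NumberField.discr K) ∧ NumberField.discr K ≠ -3 ∧ SatisfiesHeegnerHypothesis (W.conductorNorm ℤ) K ∧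
        ((Ideal.span {(2 : ℤ)}).primesOver (𝓞 K)).ncard = 2 ∧
        ∃ (Wd : WeierstrassCurve ℚ) (_ : Wd.IsElliptic) (_ : Wd.IsGloballyMinimal),
          (∃ C : VariableChange ℚ, C • W.quadraticTwist (NumberField.discr K : ℚ) = Wd) ∧ Nat.card (Wd.selmerGroup 2) = 1 := by
  intro W _ _ hrk hSel hΔ hegg
  haveI : NeZero (W.conductorNorm ℤ) := ⟨(W.conductorNorm_pos_holds).ne'⟩
  haveI : Fact (Nat.Prime 2) := ⟨Nat.prime_two⟩
  -- rank one: the ∞-relaxed Selmer group has order four, every Selmer class is trivial at `∞`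
  have hT : NoRationalTwoTorsion W := EggAllImages.noRationalTwoTorsion_of_natCard_selmerGroup_eq_two W hSel (le_of_eq hrk.symm)
  -- `E(ℚ)[2] = 0`: no non-zero `Γ_ℚ`-fixed point in `E[2]` (image `S₃` or `C₃`)
  have hnt : ∀ P : geomTorsion W (2 : ℤ), (∀ σ : absoluteGaloisGroup ℚ, σ • P = P) → P = 0 := by
    obtain ⟨-, hT2, -⟩ := rank_eq_one_and_sha_primary_eq_zero_of_natCard_selmerGroup_eq_two W hSel (le_of_eq hrk.symm)
    refine GenusKolyLowering.forall_geomTorsion_two_eq_zero_of_natCard_torsionBy_eq_one W ?_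
    rw [Nat.card_eq_one_iff_exists]
    refine ⟨⟨0, AddSubgroup.zero_mem _⟩, fun P ↦ Subtype.ext (hT2 P.1 ?_)⟩
    have h := congrArg Subtype.val (AddSubgroup.torsionBy.nsmul P)
    simp only [AddSubgroupClass.coe_nsmul, ZeroMemClass.coe_zero] at h
    convert h
  have hSha : ShaTwoTrivial W := shaTwoTrivial_of_natCard_selmerGroup_eq_two W hSel (le_of_eq hrk.symm)
  have hR4 : Nat.card (selmerGroupRelaxedAtInfinityAtTwo W) = 4 :=
    GenusKolyArch.natCard_selmerGroupRelaxedAtInfinityAtTwo_eq_four_of_not_meetsEgg W hΔ hT hrk hSha hegg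
  set R := selmerGroupRelaxedAtInfinityAtTwo W with hRdef
  haveI : Finite R := Nat.finite_of_card_ne_zero (by rw [hR4]; norm_num)
  -- two independent classes `x, y ∈ R`
  obtain ⟨x, hxR, hx0⟩ : ∃ x ∈ R, x ≠ 0 := by
    by_contra h
    push Not at h
    have : Nat.card R = 1 := by
      rw [Nat.card_eq_one_iff_exists]
      refine ⟨⟨0, R.zero_mem⟩, fun z ↦ Subtype.ext (h z.1 z.2)⟩
    rw [hR4] at this; omega
  obtain ⟨y, hyR, hy0, hyx⟩ : ∃ y ∈ R, y ≠ 0 ∧ y ≠ x := by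
    by_contra h
    push Not at h
    haveI : Fintype R := Fintype.ofFinite R
    have hsub : (Finset.univ : Finset R) ⊆ {⟨0, R.zero_mem⟩, ⟨x, hxR⟩} := by
      intro z _
      simp only [Finset.mem_insert, Finset.mem_singleton]
      by_cases hz : z.1 = 0
      · exact Or.inl (Subtype.ext hz)
      · exact Or.inr (Subtype.ext (h z.1 z.2 hz))
    have hle := Finset.card_le_card hsub
    rw [Finset.card_univ, Fintype.card_eq_nat_card, hR4] at hle
    have : ({⟨0, R.zero_mem⟩, ⟨x, hxR⟩} : Finset R).card ≤ 2 := Finset.card_le_two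
    omega
  -- `2`-torsion in `H¹(ℚ, E[2])`
  have hE2 : ∀ P : geomTorsion W ((2 : ℕ) : ℤ), 2 • P = 0 := fun P ↦ AddSubgroup.torsionBy.nsmul P
  have h2H : ∀ g : W.galH1Torsion ((2 : ℕ) : ℤ), g + g = 0 := fun g ↦ by
    rw [← two_nsmul]
    exact galoisCohomology.nsmul_eq_zero_of_forall (W.torsionGaloisModule ((2 : ℕ) : ℤ)) hE2 g
  -- Čebotarev: an identity twisting prime for the pair `(x, y)`
  have hN : W.conductorNorm ℤ ≠ 0 := (W.conductorNorm_pos_holds).ne'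
  obtain ⟨ℓ, hℓF, -, hℓ2N, hℓ8, hℓp, hfrob, hxL, hyL, hxyL⟩ :=
    exists_identityPrime_pair_not_mem_strictLocalKer_of_noFixed W hnt hΔ (x := x) (y := y) hx0 hy0 (Ne.symm hyx) hN 0
  have hℓ : ℓ.Prime := hℓF.out
  have hℓ2 : ℓ ≠ 2 := fun h ↦ hℓ2N (by rw [h]; exact dvd_mul_right 2 _)
  have hℓN : ¬ ℓ ∣ W.conductorNorm ℤ := fun h ↦ hℓ2N (h.mul_left 2)
  have hℓp' : ∀ p : ℕ, p.Prime → p ∣ W.conductorNorm ℤ → p ≠ 2 → (ℓ : ZMod p) = -1 := by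
    intro p _ hp _
    have h : ((ℓ + 1 : ℕ) : ZMod p) = 0 := (ZMod.natCast_eq_zero_iff _ _).mpr (hℓp p hp)
    rw [Nat.cast_add, Nat.cast_one] at h
    exact eq_neg_of_add_eq_zero_left h
  -- the prime Heegner field and a globally minimal model of the twist
  obtain ⟨-, -, K, _, _, hK, hd, hodd, hd3, hH, h2K, -, -⟩ := exists_heegnerField_of_prime W hℓ hℓ8 hℓp'
  have hd0 : ((NumberField.discr K : ℤ) : ℚ) ≠ 0 := by exact_mod_cast NumberField.discr_ne_zero K
  haveI := W.isElliptic_quadraticTwist hd0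
  obtain ⟨C, hC⟩ := hasGlobalMinimalModel_rat_holds (W.quadraticTwist ((NumberField.discr K : ℤ) : ℚ))
  haveI := hC
  -- the identity count and the injectivity on `R`
  have hid : Nat.card {Q : (W.baseChange ℚ_[ℓ]).toAffine.Point // 2 • Q = 0} = 4 :=
    natCard_twoTorsion_padic_eq_four_of_frob_fix W hℓ2 hℓN
      (by obtain ⟨v, 𝔓, F, hv, h𝔓, hF, hfix⟩ := hfrob; exact ⟨v, 𝔓, F, hv, h𝔓, hF, hfix⟩)
  have hinj : ∀ c ∈ R, c ∈ MazurRubin2010.strictLocalKer W ℚ_[ℓ] 2 → c = 0 :=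
    eq_zero_of_mem_of_card_eq_four R (MazurRubin2010.strictLocalKer W ℚ_[ℓ] 2) hR4 h2H hxR hyR hx0 hy0 (Ne.symm hyx) hxL hyL hxyL
  -- the count: the twin is `2`-Selmer-trivial (part 2, UNCONDITIONAL)
  have hstr := GenusKolyArch.forall_mem_selmerGroup_localization_inl_eq_zero_of_not_meetsEgg W hΔ hT hSha hegg
  have hSel1 : Nat.card ((C • W.quadraticTwist ((NumberField.discr K : ℤ) : ℚ)).selmerGroup 2) = 1 :=
    natCard_selmerGroup_twin_eq_one_of_identityDoor W hΔ hSel hK hodd hH h2K hd hid hstr hinj _ ⟨C, rfl⟩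
  exact ⟨K, inferInstance, inferInstance, ℓ, hℓF, hK, hd, hid, hinj, hodd, hd3, hH, h2K,
    C • W.quadraticTwist ((NumberField.discr K : ℤ) : ℚ), inferInstance, hC, ⟨C, rfl⟩, hSel1⟩
end Summit.BirchSwinnertonDyer.BirchSwinnertonDyer.Theorems.GenusExact.TwinSwap.IdentityDoor

end
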